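import Summits.FinalStateConjecture.Statement
import HarnessLib

/-!
# Route ClusterCompleteness · crux `OmegaLimitMultiKerr` — posited objects (D-0016 `<Route>Defs` convention)

This file carries no mathematics beyond three definitions and their definitional read-back lemmas.
It is the STABLE vocabulary over which the stubs of every line of the crux
stmt-FinalStateConjecture-14664 (`ClusterCompleteness.OmegaLimitMultiKerr`, rank 9) — and the
recurrence interface it shares verbatim with the route's target `RecurrentMultiKerrCapture` (X) and
with `RecurrentlyFlatDisperses` — are naturally stated, moved out of the crux workfiles
(`Cruxes/OmegaLimitMultiKerr/SketchIdeator2.lean` §0, ideator 2; `Lines/Sketch.lean`, lead 0) so that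
stub proofs and skeletons can import it from `Theorems/…` (the route rationale itself asks for it:
"Settles 𝒟 and OmegaLimitMultiKerr share one definition instead of a duplicated term"):

* `Settles 𝒟` — the SETTLE disjunct for one maximal development: complete `𝓘⁺` and an exhaustive
  `C²` sub-extremal multi-Kerr decomposition of its self-determined exterior — VERBATIM the
  `∀`-MGHD conjunct of the lambda of `FinalStateConjecture` AS FILED BEFORE the Statement re-type T2
  of 2026-08-16T21:18Z (since then the summit only IMPLIES `Settles`-genericity,
  `settlesGeneric_of_finalStateConjecture`; the verbatim matrix of the re-typed Statement is
  `SettlesT2` of `…OmegaLimitMultiKerrT2Defs.lean`, `finalStateConjecture_iff_tame` is `Iff.rfl`)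
  and the negated conjunct of `OmegaLimitMultiKerr` as filed at rev 16;
* `Recurs k 𝒟` — the RECUR disjunct at order `k`: anchored, separating, exhaustive final-state-shaped
  late charts in which `Cᵏ` `ε`-closeness to one sub-extremal multi-Kerr configuration recurs for
  every `ε` and every near-zone radius — VERBATIM the conclusion of `OmegaLimitMultiKerr` and the
  hypothesis of `RecurrentMultiKerrCapture` (the certificates `omegaLimitMultiKerr_iff :
  OmegaLimitMultiKerr ↔ ∀ k, OmegaAt k` and `recurrentMultiKerrCapture_iff : X ↔ ∃ k, ∀ …, Recurs k 𝒟
  → Settles 𝒟`, both `Iff.rfl`, live with the route-importing spine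
  `ClusterCompletenessOmegaLimitMultiKerrSpine.lean`, since this module must not import the route
  file);
* `OmegaAt k` — the crux at ONE order `k`.

Everything is a definition over EXISTING declarations (`admissibleVacuumData`,
`VacuumCauchyDevelopment`, `FinalStateDecomposition`, `Spacetime.IsLateChart / deviationCk /
truncDeviationCk`, `boostedKerrExterior / boostedKerrBackground`, `Minkowski.backgroundOn`,
`Summit.FinalStateConjecture.HasCompleteNullInfinity / exteriorOf / HasExhaustiveCharts`); nothing
restates a route item under a new name (the items are the generic statements; these are their
per-development matrices), and `recurs_anti` records the one structural fact used everywhere (the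
recur-disjunct is antitone in the order). DEDUP NOTE: `Settles`, `Recurs`, `OmegaAt` are verbatim
copies of `Cruxes/OmegaLimitMultiKerr/SketchIdeator2.lean` §0 (a crux WORKFILE, not importable from
`Theorems/`); once this module lands, crux workfiles and lines should import it and drop their copies.
Why ONE generic statement per order and no finer generic split: the conjunction glue for
Christodoulou's curve-genericity is false (`Theorems.TameCensorship.Negative.isChristodoulouGeneric_and_fails`,
kernel-checked), so only `∀`-data pieces can be split off `OmegaAt k`; classwide vacuity is excluded
by `Literature.Geometry.Lorentzian.admissibleVacuumData_slice_nonempty`.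
-/

-- every `Summit.FinalStateConjecture.FinalStateConjecture.…` name repeats the summit = sub-problem segment (D-0017 layout)
set_option linter.dupNamespace false

noncomputable section

open scoped Manifold ContDiff Topology ENNReal
open Set Filter TopologicalSpace

namespace Summit.FinalStateConjecture.FinalStateConjecture.Theorems.ClusterCompleteness

open Literature.Geometry.Lorentzian

section PerDevelopment

variable {X : Type} [TopologicalSpace X] [ChartedSpace E3 X] [IsManifold (𝓡 3) ∞ X]
  [ConnectedSpace X] {D : InitialDataSet (𝓡 3) X}

/-- **Settles down** (one maximal development `𝒟`): complete future null infinity in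
Christodoulou's sojourn sense AND a `C²` final-state decomposition of the self-determined exterior
`O = J⁺(Σ) ∩ I⁻(charted)` into finitely many SUB-EXTREMAL boosted Kerr near zones plus a flat
radiation zone whose charts EXHAUST `O` — verbatim the `∀`-MGHD conjunct of `FinalStateConjecture`
(Dafermos–Luk arXiv:1710.01722, Conjecture 1 and §1.2.1). [cite: DafermosLuk2017, §1.2.1] -/
def Settles (𝒟 : VacuumCauchyDevelopment D) : Prop :=
  Summit.FinalStateConjecture.HasCompleteNullInfinity 𝒟.toCauchyDevelopment ∧
    ∃ (O : Set 𝒟.carrier) (d : FinalStateDecomposition 𝒟.toSpacetime O 2),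
      (∀ i, Kerr.IsSubextremal (d.mass i) (d.spin i)) ∧
        O = Summit.FinalStateConjecture.exteriorOf 𝒟.toCauchyDevelopment d.charted ∧
          Summit.FinalStateConjecture.HasExhaustiveCharts d

/-- **Recurs at order `k`** (one maximal development `𝒟`): there are `N ≥ 0` sub-extremal labels
`(Mᵢ, aᵢ)`, motions `(Λᵢ, cᵢ)`, a late time `τ₀`, hole charts `Ψᵢ` on the boosted Kerr exteriors
and a flat chart `Ψ₀` on `U₀ ⊇ {x⁰ > τ₀} ∖ (sublinear tubes)`, all late charts into the
self-determined exterior `O = exteriorOf(charted)`, with near-zone radii `Rᵢ → ∞` serving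
EXHAUSTION of `O` at every chart time `τ₁ > τ₀` and a uniform `C⁰` ANCHOR (deviation `≤ 1/4` on
every flat slab and every certified near-zone slab), the holes SEPARATING for every radius, such
that `Cᵏ` `ε`-closeness to this one configuration recurs (`∃ᶠ τ`) for every `ε > 0` and every
near-zone radius `R'` — verbatim the conclusion of `ClusterCompleteness.OmegaLimitMultiKerr` at
order `k` and the hypothesis of `ClusterCompleteness.RecurrentMultiKerrCapture` (route rev 16,
the refuter-repaired anchored interface). [cite: DafermosLuk2017, §1.2.1] -/
def Recurs (k : ℕ) (𝒟 : VacuumCauchyDevelopment D) : Prop :=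
  ∃ (O : Set 𝒟.carrier) (N : ℕ) (M a : Fin N → ℝ) (mo : Fin N → lorentzGroup × E4) (τ₀ : ℝ)
    (Ψ : ∀ i, boostedKerrExterior (mo i).1 (mo i).2 (M i) (a i) → 𝒟.carrier)
    (ρ R : Fin N → ℝ → ℝ) (U₀ : Opens E4) (Ψ₀ : U₀ → 𝒟.carrier),
    (∀ i, Kerr.IsSubextremal (M i) (a i)) ∧
    (∀ i, 𝒟.toSpacetime.IsLateChart (boostedKerrBackground (mo i).1 (mo i).2 (M i) (a i)) O τ₀
      (Ψ i)) ∧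
    𝒟.toSpacetime.IsLateChart (Minkowski.backgroundOn U₀) O τ₀ Ψ₀ ∧
    (∀ i, Tendsto (fun t ↦ ρ i t / t) atTop (𝓝 0)) ∧ (∀ i, Tendsto (R i) atTop atTop) ∧
    {x : E4 | τ₀ < x 0 ∧ ∀ i, ρ i (x 0) <
      Kerr.radius (a i) (poincareInv (mo i).1 (mo i).2 x)} ⊆ (U₀ : Set E4) ∧
    (∀ R' : ℝ, ∃ τ₁ : ℝ, Pairwise (Function.onFun Disjoint fun i ↦ Ψ i ''
      (boostedKerrBackground (mo i).1 (mo i).2 (M i) (a i)).truncLateRegion τ₁ R')) ∧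
    O = Summit.FinalStateConjecture.exteriorOf 𝒟.toCauchyDevelopment
      ((⋃ i, Ψ i '' (boostedKerrBackground (mo i).1 (mo i).2 (M i) (a i)).lateRegion τ₀) ∪
        Ψ₀ '' (Minkowski.backgroundOn U₀).lateRegion τ₀) ∧
    (∀ τ₁ : ℝ, τ₀ < τ₁ → O \ (Ψ₀ '' (Minkowski.backgroundOn U₀).lateRegion τ₁ ∪
      ⋃ i, Ψ i '' {x | τ₁ < (boostedKerrBackground (mo i).1 (mo i).2 (M i) (a i)).time x.1 ∧
        (boostedKerrBackground (mo i).1 (mo i).2 (M i) (a i)).radius x.1 ≤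
          R i ((boostedKerrBackground (mo i).1 (mo i).2 (M i) (a i)).time x.1)}) ⊆
      𝒟.metric.causalPast 𝒟.timeOrientation (Ψ₀ '' (Minkowski.backgroundOn U₀).timeSlab τ₁ ∪
        ⋃ i, Ψ i '' (boostedKerrBackground (mo i).1 (mo i).2 (M i) (a i)).truncTimeSlab
          (R i τ₁) τ₁)) ∧
    (∀ τ : ℝ, τ₀ < τ →
      𝒟.toSpacetime.deviationCk (Minkowski.backgroundOn U₀) Ψ₀ 0 τ ≤ ENNReal.ofReal (1 / 4) ∧
      ∀ i, 𝒟.toSpacetime.truncDeviationCk (boostedKerrBackground (mo i).1 (mo i).2 (M i) (a i))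
        (Ψ i) 0 (R i τ) τ ≤ ENNReal.ofReal (1 / 4)) ∧
    ∀ R' : ℝ, ∀ ε : ℝ, 0 < ε → ∃ᶠ τ in atTop,
      𝒟.toSpacetime.deviationCk (Minkowski.backgroundOn U₀) Ψ₀ k τ ≤ ENNReal.ofReal ε ∧
      ∀ i, 𝒟.toSpacetime.truncDeviationCk (boostedKerrBackground (mo i).1 (mo i).2 (M i) (a i))
        (Ψ i) k R' τ ≤ ENNReal.ofReal ε

/-- **The recur-disjunct is antitone in the order**: recurrence at order `k'` implies recurrence at
every `k ≤ k'`, with the same configuration and charts (only the last clause mentions the order,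
and `Cᵏ` sup norms are monotone in `k`, `supCkENorm_mono_right`). [folklore] -/
theorem recurs_anti {k k' : ℕ} (hk : k ≤ k') {𝒟 : VacuumCauchyDevelopment D} (h : Recurs k' 𝒟) :
    Recurs k 𝒟 := by
  obtain ⟨O, N, M, a, mo, τ₀, Ψ, ρ, R, U₀, Ψ₀, h₁, h₂, h₃, h₄, h₅, h₆, h₇, h₈, h₉, h₁₀, h₁₁⟩ := h
  refine ⟨O, N, M, a, mo, τ₀, Ψ, ρ, R, U₀, Ψ₀, h₁, h₂, h₃, h₄, h₅, h₆, h₇, h₈, h₉, h₁₀, ?_⟩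
  intro R' ε hε
  refine (h₁₁ R' ε hε).mono fun τ hτ ↦ ⟨?_, fun i ↦ ?_⟩
  · exact (𝒟.toSpacetime.deviationCk_mono (Minkowski.backgroundOn U₀) Ψ₀ hk τ).trans hτ.1
  · exact (supCkENorm_mono_right _ hk _).trans (hτ.2 i)

end PerDevelopment

/-- **The crux at ONE order `k`**: for every connected Hausdorff second-countable smooth
`3`-manifold, Christodoulou-generically in the admissible class, an MGHD exists and every MGHD that
does not settle down recurs at order `k` — verbatim the `k`-instance of
`ClusterCompleteness.OmegaLimitMultiKerr` (certificate `omegaLimitMultiKerr_iff`, `Iff.rfl`, in the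
spine file). Antitone in `k` (`omegaAt_anti`). [cite: DafermosLuk2017, §1.2.1] -/
def OmegaAt (k : ℕ) : Prop :=
  ∀ (X : Type) [TopologicalSpace X] [ChartedSpace E3 X] [IsManifold (𝓡 3) ∞ X] [T2Space X]
    [SecondCountableTopology X] [ConnectedSpace X],
    InitialDataSet.IsChristodoulouGeneric (admissibleVacuumData X)
      (fun D ↦ (∃ 𝒟 : VacuumCauchyDevelopment D, 𝒟.IsMaximal) ∧
        ∀ 𝒟 : VacuumCauchyDevelopment D, 𝒟.IsMaximal → ¬ Settles 𝒟 → Recurs k 𝒟) 1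

/-- **The summit implies `Settles`-genericity with anti-vacuity.** Since the re-type T2 of the
Statement (2026-08-16T21:18Z: TAME Christodoulou genericity `IsTameChristodoulouGeneric`, and the
settle clause gained `RaysStayInClosure` and `IsFutureOriented`), `FinalStateConjecture` is no longer
LITERALLY `Settles`-genericity — its `Iff.rfl` read-back is `finalStateConjecture_iff_tame` of
`…OmegaLimitMultiKerrT2Defs.lean` (matrix `SettlesT2`) — but it still IMPLIES it: tame genericity
implies the topology-free notion (`IsTameChristodoulouGeneric.isChristodoulouGeneric`), genericity is
monotone in the property (`IsChristodoulouGeneric.mono`), and the re-typed settle clause implies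
`Settles` (forget the two new conjuncts). This is the surviving direction of the former `Iff.rfl`
lemma `finalStateConjecture_iff` (full-build repair 2026-08-16; the old name is kept below as a
deprecated alias). [folklore] -/
theorem settlesGeneric_of_finalStateConjecture :
    FinalStateConjecture →
      ∀ (X : Type) [TopologicalSpace X] [ChartedSpace E3 X] [IsManifold (𝓡 3) ∞ X] [T2Space X]
        [SecondCountableTopology X] [ConnectedSpace X],
        InitialDataSet.IsChristodoulouGeneric (admissibleVacuumData X)
          (fun D ↦ (∃ 𝒟 : VacuumCauchyDevelopment D, 𝒟.IsMaximal) ∧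
            ∀ 𝒟 : VacuumCauchyDevelopment D, 𝒟.IsMaximal → Settles 𝒟) 1 :=
  fun h X _ _ _ _ _ _ ↦ (h X).isChristodoulouGeneric.mono fun _ _ hP ↦
    ⟨hP.1, fun 𝒟 h𝒟 ↦ by
      obtain ⟨hI, O, d, hsub, hO, -, hex, -⟩ := hP.2 𝒟 h𝒟
      exact ⟨hI, O, d, hsub, hO, hex⟩⟩

/-- Deprecated name of `settlesGeneric_of_finalStateConjecture`: before the re-type T2 of the
Statement it was the `Iff.rfl` read-back `FinalStateConjecture ↔ (Settles-genericity)`, whose `←`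
direction the re-typed Statement no longer grants; the `Iff.rfl` read-back is now
`finalStateConjecture_iff_tame` (`…T2Defs.lean`). [folklore] -/
@[deprecated settlesGeneric_of_finalStateConjecture (since := "2026-08-16")]
alias finalStateConjecture_iff := settlesGeneric_of_finalStateConjecture

/-- The crux at order `k'` implies it at every order `k ≤ k'` (monotonicity of genericity in the
property and `recurs_anti`): the `∀ k` of `OmegaLimitMultiKerr` is carried by large `k`.
[folklore] -/
theorem omegaAt_anti {k k' : ℕ} (hk : k ≤ k') (h : OmegaAt k') : OmegaAt k := by
  intro X _ _ _ _ _ _ d hd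
  obtain ⟨F, hF, h0, hinj, hadm, hexc⟩ := h X d
    ⟨hd.1, fun hP ↦ hd.2 ⟨hP.1, fun 𝒟 h𝒟 hS ↦ recurs_anti hk (hP.2 𝒟 h𝒟 hS)⟩⟩
  exact ⟨F, hF, h0, hinj, hadm, fun c hc hmem ↦ hexc c hc
    ⟨hmem.1, fun hP ↦ hmem.2 ⟨hP.1, fun 𝒟 h𝒟 hS ↦ recurs_anti hk (hP.2 𝒟 h𝒟 hS)⟩⟩⟩

/-- The summit implies the crux at every order (the settle branch short-circuits the dichotomy;
genericity is monotone in the property; since the re-type T2 of the Statement, via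
`settlesGeneric_of_finalStateConjecture`: tame ⟹ topology-free genericity and the re-typed settle
clause implies `Settles`). [folklore] -/
theorem omegaAt_of_finalStateConjecture (h : FinalStateConjecture) (k : ℕ) : OmegaAt k :=
  fun X _ _ _ _ _ _ ↦ (settlesGeneric_of_finalStateConjecture h X).mono fun _ _ hP ↦
    ⟨hP.1, fun 𝒟 h𝒟 hS ↦ absurd (hP.2 𝒟 h𝒟) hS⟩

end Summit.FinalStateConjecture.FinalStateConjecture.Theorems.ClusterCompleteness
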